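import Literature.Computation.KummerOrbifold.Certificate5
import HarnessLib

/-!
# Kummer orbifold model, `m = 5` (`Kum⁴`): the CLOSURE certificate — `C₀ = R`, `dim C₀ = 1566`
# (COMPUTATIONAL, `native_decide`; cell `hodge-kum4`, seat p1; MODEL_X consumer spec 2ea65998af615100)

EVIDENCE for the COMPUTED clause of the route item `Summit.Ventures.HodgeKum4.KummerOrbifoldModelKum4`
(MODEL_X, stmt-Ventures-19267): `range φ = modelSpace ∧ Injective φ` amounts to
**`C₀ = R`**, where `C₀ = modelSpace` (`Model5`: the closure of the 17 seeds under `Λ₀ = lamOp` and the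
16 generator products `genOp j`) and `R ⊂ ℚ^{N5}` is the sub-space of CENTRALIZER-INVARIANT vectors
of the raw layout (block by block: the `𝔖₅`-invariant classes of the Fu–Tian–Vial / Fantechi–Göttsche
ring in rep coordinates), of dimension `1566 = dim H*(X;ℂ)^Γ` (Göttsche–Soergel Betti numbers, Foster
Rmk. 88).  Like `replay5` this file is NOT used by the kernel assembly; it certifies numbers.

What is checked (all by `native_decide`, every step exact or lifting from characteristic `p` to `0`):
* `molien5` — **(C2)** the Molien/trace count of `dim R` per degree (exact integer arithmetic,
  `Model.expectedBetti`) is `[1,0,7,8,36,64,168,288,422,288,168,64,36,8,7,0,1]` (Σ = 1566).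
* `rankWords5` — **(C1) lower bound**: the graded rank MODULO `p = 2³¹ − 1` of the 1567 replayed word
  vectors `words5` (rational entries mapped by `Model.ratModP`, i.e. numerator · denominator⁻¹ mod `p`;
  no denominator is divisible by `p`) is that same vector.  Independence mod `p` of (integralised)
  vectors implies independence over `ℚ`, so `dim C₀ ≥ dim span(words) = 1566` (`span(words) ⊆ C₀` is
  the in-kernel `replay_mem`).
* `reynoldsBasis5_profile`, `reynoldsBasis5_rank`, `reynoldsBasis5_invariant` — **(C3a)** the Reynolds
  basis `B` (`Model.blockBasis`, all blocks and degrees, re-encoded in the raw layout) has the Molien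
  size profile, graded rank mod `p` equal to it (so `B` is linearly independent over `ℚ`), and every
  `b ∈ B` IS centralizer-invariant (exact check: `σ_* b = b` after reduction, for a generating set of each
  centralizer) — hence `span B = R` (Molien's theorem gives `dim R` exactly).
* `seeds5_invariant` (here) and `images5_invariant_I` / `images5_invariant_II` (sequel modules
  `ClosureCertificate5ImagesI/II`, split only for elaboration time) — **(C3b) upper bound**: the 17
  seeds are invariant, and for EVERY `b ∈ B` and EVERY operator `T ∈ {Λ₀, G_0, …, G_15}` the image
  `T b` (computed in the raw layout with the replay kernel `applyIn`) is centralizer-invariant (exact).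
  Hence `T(R) ⊆ R`, the seeds lie in `R`, so `C₀ ⊆ R` and `dim C₀ ≤ 1566` — WITHOUT any mod-`p`
  closure or rational elimination.
Together: **`C₀ = R` and `dim C₀ = 1566`** (both inequalities); and since the upper bound does not use
the words, `span(words) = C₀ = R` follows as well.  Deviation from the consumer spec (an economy, same
logic): the invariance checks (C3) run on the REYNOLDS basis `B` of `R` (sparse orbit sums) instead of on
the 1567 words; the words enter only through the rank (C1).  The spec's names are provided as aliases:
`molienCheck5_eq`, `rankCheck5_eq`, `invCheck5_eq` (this module; `invCheck5` = basis + seeds invariance)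
and the image checks in the sequels.  The Poincaré-duality by-product (C4) is not included.

What is NOT certified here (unchanged): that the engine IS Fu–Tian–Vial's ring with Fantechi–Göttsche's
product, and the transport `K⁴(A) ⇝ X` — the printed identification half of MODEL_X (FTV19 Thm 1.4/1.5,
FG03 Thm 3.10, BNWS 3.3(2), HT13 Thm 2.1, Ehresmann), which stays CITED; the item stays `@[conjecture]`.
Acceptance check (consumer spec): this module elaborates (`lean check`, rc 0, no `sorry`), the expected
vectors appear LITERALLY in the theorem statements below, and `#print axioms` of the route closers does
not mention this file.

Sources: as `Certificate5` (Fu–Tian–Vial 2019 Thm 1.5; Fantechi–Göttsche 2003 §3; Looijenga–Lunts 1997 §1).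
-/

set_option autoImplicit false

namespace Literature.Computation.KummerOrbifold

open Literature.Computation.Sparse

/-! ## The expected graded dimension vector -/

/-- The graded dimensions of the `Γ`-invariant cohomology of `Kum⁴` (Betti numbers of `Kum⁴` with
`1046 − 624 = 422` in the middle): the vector every check below is compared with. [cite: GreenKimLazaRobles2022, Cor. 32 (Kum_n LLV decompositions; Betti numbers)] -/
def invariantBetti5 : List ℕ := [1, 0, 7, 8, 36, 64, 168, 288, 422, 288, 168, 64, 36, 8, 7, 0, 1]

/-! ## (C2) Molien / trace count of `dim R` -/

/-- **(C2)** The Molien count of the centralizer-invariant sub-space `R` of the raw layout, per total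
degree, is the invariant Betti vector (exact integer arithmetic). [cite: GreenKimLazaRobles2022, Cor. 32 (Kum_n LLV decompositions; Betti numbers)] -/
theorem molien5 : M5.expectedBetti.toList = [1, 0, 7, 8, 36, 64, 168, 288, 422, 288, 168, 64, 36, 8, 7, 0, 1] := by
  native_decide

/-! ## (C1) Graded rank of the replayed words modulo `p = 2³¹ − 1` -/

/-- A raw sparse vector as a mod-`p` hash vector (`p = Model.PRIME = 2³¹ − 1`; rational entries mapped
by `Model.ratModP`; repeated indices are summed). [folklore] -/
def spToVecP (w : SpVec) : Model.VecP :=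
  w.foldl (fun (v : Model.VecP) q ↦
    let x := (v.getD q.1 0 + Model.ratModP q.2) % Model.PRIME
    if x == 0 then v.erase q.1 else v.insert q.1 x) (Std.HashMap.emptyWithCapacity 64)

/-- `true` iff no entry of the vector has a denominator divisible by `p` (so that reduction mod `p` is
the reduction of an integral multiple). [folklore] -/
def denomsOK (w : SpVec) : Bool := w.all fun q ↦ q.2.den % Model.PRIME != 0

/-- Graded rank profile modulo `p` of a family of (degree, vector) pairs: for each degree
`k = 0, …, top`, the number of pivots of the semi-echelon form (`Model.EchelonP`) of the vectors of
that degree. [folklore] -/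
def rankProfile (W : Array (ℕ × SpVec)) (top : ℕ) : List ℕ :=
  (List.range (top + 1)).map fun k ↦
    (W.foldl (fun (E : Model.EchelonP) p ↦ if p.1 == k then (E.push (spToVecP p.2)).1 else E)
      Model.EchelonP.empty).pivots.size

/-- **(C1)** The 1567 replayed word vectors have graded rank `[1,0,7,…,1]` (Σ = 1566) modulo
`p = 2³¹ − 1`, and no denominator is divisible by `p`: the words are linearly independent over `ℚ`,
degree by degree, with the invariant Betti profile — `dim C₀ ≥ 1566`. [cite: FuTianVial2019, Thm. 1.5 (and Thm. 1.4; the orbifold product of §2 with discrete torsion)] -/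
theorem rankWords5 :
    (words5.size == 1567 && words5.all (fun p ↦ denomsOK p.2) &&
      rankProfile words5 16 == [1, 0, 7, 8, 36, 64, 168, 288, 422, 288, 168, 64, 36, 8, 7, 0, 1]) = true := by
  native_decide

/-! ## (C3a) The Reynolds basis of `R` and centralizer invariance -/

/-- The Reynolds basis of the invariant sub-space `R`: for every block (rep position `ri`, internal
degree `d`) the `Model.blockBasis` vectors (as many as the Molien count asks for, if found), as
(rep position, total degree, reduced element). [cite: FuTianVial2019, Thm. 1.5 (and Thm. 1.4; the orbifold product of §2 with discrete torsion)] -/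
def reynoldsBasis5 : Array (ℕ × ℕ × Ext) := Id.run do
  let Mo := M5
  let mut out : Array (ℕ × ℕ × Ext) := #[]
  for ri in [0:Mo.reps.size] do
    let r := Mo.reps[ri]!
    let sh := Mo.sec[r]!.shift
    let ed := Mo.expectedDims ri
    for d in [0:ed.size] do
      if ed[d]! > 0 then
        let (vecs, _) := Mo.blockBasis ri d ed[d]!
        for v in vecs do out := out.push (ri, sh + d, v)
  return out

/-- The Reynolds basis encoded in the raw layout, as (degree, sparse vector). [folklore] -/
def reynoldsBasis5Sp : Array (ℕ × SpVec) :=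
  reynoldsBasis5.map fun t ↦ (t.2.1, M5.encodeExt L5 t.1 t.2.2)

/-- The subgroup of `𝔖₅` (as indices of `M5.G`) generated by `gens`: closure under left
multiplication by the generators (finite group, so this is the generated subgroup). [folklore] -/
def generatedSubgroup (gens : Array ℕ) : Array ℕ := Id.run do
  let Mo := M5
  let mut elems : Array ℕ := #[Mo.idIdx]
  let mut seen : Std.HashSet ℕ := (Std.HashSet.emptyWithCapacity 128).insert Mo.idIdx
  let mut i := 0
  -- BFS; `elems.size ≤ |𝔖₅| = 120` bounds the loop
  while h : i < elems.size do
    let x := elems[i]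
    for g in gens do
      let y := (Mo.comp.getD g #[]).getD x 0
      if !seen.contains y then
        seen := seen.insert y
        elems := elems.push y
    i := i + 1
    if elems.size > 130 then break
  return elems

/-- A generating set of the centralizer of each class representative (greedy: add an element of the
centralizer whenever it is not yet generated). [folklore] -/
def centGens5 : Array (Array ℕ) :=
  (Array.range M5.reps.size).map fun ri ↦ Id.run do
    let cent := M5.cent.getD ri #[]
    let mut gens : Array ℕ := #[]
    let mut sub : Std.HashSet ℕ := (Std.HashSet.emptyWithCapacity 128).insert M5.idIdx
    for c in cent do
      if !sub.contains c then
        gens := gens.push c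
        sub := (generatedSubgroup gens).foldl (fun s x ↦ s.insert x) (Std.HashSet.emptyWithCapacity 128)
    return gens

/-- `true` iff the generating sets generate the full centralizers (sizes agree). [folklore] -/
def centGensOK5 : Bool :=
  (List.range M5.reps.size).all fun ri ↦
    (generatedSubgroup (centGens5.getD ri #[])).size == (M5.cent.getD ri #[]).size

/-- Centralizer invariance of a reduced element `x` of the block at rep position `ri`:
`reduce (σ_* x) = reduce x` for every generator `σ` of the centralizer. [cite: FantechiGoettsche2003, §3 (Thm. 3.10, the ring structure; genus/obstruction rule)] -/
def isInvariantExt (ri : ℕ) (x : Ext) : Bool :=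
  let r := M5.reps.getD ri 0
  let sec := M5.sec.getD r default
  let xr := sec.reduce x
  (centGens5.getD ri #[]).all fun c ↦ Ext.beq (sec.reduce (M5.push c r x).2) xr

/-- Decode a raw sparse vector into its block components (rep position ↦ element in reduced rep
coordinates); `none` if a point index occurs (there is none in this layout). [folklore] -/
def decodeSp (w : SpVec) : Option (Std.HashMap ℕ Ext) :=
  w.foldl (fun acc q ↦ match acc with
    | none => none
    | some mp =>
      let dec := L5.decode q.1
      let ri := dec.2.1
      let mask := dec.2.2
      if mask ≥ 2 ^ 32 then none else
      some (mp.insert ri ((mp.getD ri Ext.mk).addTerm mask q.2))) (some (Std.HashMap.emptyWithCapacity 8))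

/-- Centralizer invariance of a raw sparse vector: every block component is invariant. [folklore] -/
def isInvariantSp (w : SpVec) : Bool :=
  match decodeSp w with
  | none => false
  | some mp => mp.toList.all fun q ↦ isInvariantExt q.1 q.2

/-- **(C3a, size)** The Reynolds basis has the Molien size profile: `Model.blockBasis` FOUND as many
independent invariant vectors as the Molien count predicts, in every degree (and the centralizer
generating sets are complete). [cite: FuTianVial2019, Thm. 1.5 (and Thm. 1.4; the orbifold product of §2 with discrete torsion)] -/
theorem reynoldsBasis5_profile :
    (centGensOK5 &&
      ((List.range 17).map fun k ↦ (reynoldsBasis5Sp.filter fun p ↦ p.1 == k).size) ==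
        [1, 0, 7, 8, 36, 64, 168, 288, 422, 288, 168, 64, 36, 8, 7, 0, 1]) = true := by
  native_decide

/-- **(C3a, rank)** The Reynolds basis, re-encoded in the raw layout, has graded rank `[1,0,7,…,1]`
modulo `p` (denominators prime to `p`): it is linearly independent over `ℚ`. [cite: FuTianVial2019, Thm. 1.5 (and Thm. 1.4; the orbifold product of §2 with discrete torsion)] -/
theorem reynoldsBasis5_rank :
    (reynoldsBasis5Sp.all (fun p ↦ denomsOK p.2) &&
      rankProfile reynoldsBasis5Sp 16 == [1, 0, 7, 8, 36, 64, 168, 288, 422, 288, 168, 64, 36, 8, 7, 0, 1]) = true := by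
  native_decide

/-- **(C3a, invariance)** Every Reynolds basis vector IS centralizer-invariant (exact check on the raw
encoding, block by block): `span B ⊆ R`, hence `span B = R` by the Molien count. [cite: FantechiGoettsche2003, §3 (Thm. 3.10, the ring structure; genus/obstruction rule)] -/
theorem reynoldsBasis5_invariant : reynoldsBasis5Sp.all (fun p ↦ isInvariantSp p.2) = true := by
  native_decide

/-! ## (C3b) Invariance of the seeds and of all operator images of the basis -/

/-- **(C3b, seeds)** The 17 seed vectors are centralizer-invariant (`seeds ⊆ R`). [cite: FuTianVial2019, Thm. 1.5 (and Thm. 1.4; the orbifold product of §2 with discrete torsion)] -/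
theorem seeds5_invariant : (seeds5.size == 17 && seeds5.all fun p ↦ isInvariantSp p.2) = true := by
  native_decide

/-- The target degree of operator `op5 j` on a vector of degree `k` (`Λ₀`: `k − 2`; `G_j`: `k +` the
degree of generator `j`), or `none` outside `0 … 16`. [folklore] -/
def targetDeg (j k : ℕ) : Option ℕ :=
  if j = 0 then (if 2 ≤ k then some (k - 2) else none)
  else
    let k' := k + (gens5.getD (j - 1) (0, Model.Cls.mk)).1
    if k' ≤ 16 then some k' else none

/-- The image of a raw vector of degree `k` under operator `op5 j`, placed in its degree segment
(`none` = the operator maps degree `k` outside the model, i.e. the image is `0`; `some none` would be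
an out-of-segment entry — reported as a failure by the checks). [folklore] -/
def imageIn (j k : ℕ) (v : SpVec) : Option (Option SpVec) :=
  match targetDeg j k with
  | none => none
  | some k' => some (applyIn ctx5 (op5 j) k' v)

/-- The images of a (degree, vector) pair under the operators `op5 j`, `j ∈ ops`, are all
centralizer-invariant (and land in their degree segments). [folklore] -/
def imagesInvariantOps (ops : List ℕ) (p : ℕ × SpVec) : Bool :=
  ops.all fun j ↦
    match imageIn j p.1 p.2 with
    | none => true
    | some none => false
    | some (some tv) => isInvariantSp tv

/-! The image checks **(C3b, images)** — `T(R) ⊆ R` for all 17 operators — are the expensive part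
(≈ 20 min of native evaluation in one piece); they live in the two sequel modules
`ClosureCertificate5ImagesI` (operators `op5 0 … op5 11`: `Λ₀`, the untwisted degree-2 generators, `δ`,
the untwisted degree-3 generators) and `ClosureCertificate5ImagesII` (operators `op5 12 … op5 16`: the
twisted degree-3 generators and `ω₀`).  The conclusion `C₀ = R`, `dim C₀ = 1566` uses this module AND both
sequels. -/


/-! ## The consumer spec's names (aliases; no recomputation) -/

/-- `molienCheck5`: the Molien count equals the invariant Betti vector. [cite: GreenKimLazaRobles2022, Cor. 32 (Kum_n LLV decompositions; Betti numbers)] -/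
def molienCheck5 : Bool := M5.expectedBetti.toList == invariantBetti5

/-- **(C2)** under the spec's name. [cite: GreenKimLazaRobles2022, Cor. 32 (Kum_n LLV decompositions; Betti numbers)] -/
theorem molienCheck5_eq : molienCheck5 = true := by
  unfold molienCheck5 invariantBetti5
  rw [molien5]
  decide

/-- `rankCheck5`: the graded mod-`p` rank of the replayed words is the invariant Betti vector (with the
size and denominator side conditions). [folklore] -/
def rankCheck5 : Bool :=
  words5.size == 1567 && words5.all (fun p ↦ denomsOK p.2) &&
    rankProfile words5 16 == [1, 0, 7, 8, 36, 64, 168, 288, 422, 288, 168, 64, 36, 8, 7, 0, 1]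

/-- **(C1)** under the spec's name (graded rank of the replayed words mod `p`). [cite: FuTianVial2019, Thm. 1.5 (and Thm. 1.4; the orbifold product of §2 with discrete torsion)] -/
theorem rankCheck5_eq : rankCheck5 = true := rankWords5

/-- `invCheck5`: the Reynolds basis has the Molien profile and full graded rank, and the basis vectors
and the seeds are centralizer-invariant (the image checks are `images5_invariant_I/II`). [folklore] -/
def invCheck5 : Bool :=
  (centGensOK5 &&
      ((List.range 17).map fun k ↦ (reynoldsBasis5Sp.filter fun p ↦ p.1 == k).size) ==
        [1, 0, 7, 8, 36, 64, 168, 288, 422, 288, 168, 64, 36, 8, 7, 0, 1]) &&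
  (reynoldsBasis5Sp.all (fun p ↦ denomsOK p.2) &&
      rankProfile reynoldsBasis5Sp 16 == [1, 0, 7, 8, 36, 64, 168, 288, 422, 288, 168, 64, 36, 8, 7, 0, 1]) &&
  reynoldsBasis5Sp.all (fun p ↦ isInvariantSp p.2) &&
  (seeds5.size == 17 && seeds5.all fun p ↦ isInvariantSp p.2)

/-- **(C3a) + seeds** under the spec's name (Reynolds basis of the invariant ring: profile, rank, invariance; seeds invariant). [cite: FuTianVial2019, Thm. 1.5 (and Thm. 1.4; the orbifold product of §2 with discrete torsion)] -/
theorem invCheck5_eq : invCheck5 = true := by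
  unfold invCheck5
  rw [reynoldsBasis5_profile, reynoldsBasis5_rank, reynoldsBasis5_invariant, seeds5_invariant]
  rfl

end Literature.Computation.KummerOrbifold
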